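import Summits.QuantumFields.BalabanUV.Beta.GAN24.ExitDefectContourSums

/-!
# `BalabanUV.Beta.GAN24.BlockWeightContourCommutation` — binder row G-an2-4 ∕ (CONV-C), the (S) row ∕ (W-γ) toolkit one level up:
# **COMMUTING A BLOCK-CONSTANT WEIGHT THROUGH THE STRAIGHT-CONTOUR BLOCK SUM — the end-point weight `Ψ⁺`, the base-point weight `Ψ` and the bond sum `σ_Ψ = Ψ + Ψ⁺`
# leave exactly the «END-INSIDE» and «BASE-OUTSIDE» PARTIAL CONTOUR SUMS as defects:**
# `𝒬_L(Ψ⁺⊙v) κ w = ψ(w+e_κ)·𝒬_L v κ w − (dz ψ) κ w·EI_L v κ w`,  `𝒬_L(Ψ⊙v) κ w = ψ w·𝒬_L v κ w + (dz ψ) κ w·BO_L v κ w`,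
# `𝒬_L(σ_Ψ⊙v) κ w = σ_ψ κ w·𝒬_L v κ w + (dz ψ) κ w·(BO_L v κ w − EI_L v κ w)`   (`Ψ = ψ ∘ blk L`)
# (G-an2-4 CRUX TEAM (2), seat `b2b-balaban-gan24-formalise-leaf-06` = the (γ) hand, gen 49, FILE (α))

NOT IN PRINT; OUR BOOKKEEPING ([folklore] finite sums along the straight block contours of `AffineAveraging.contourSum`; leaf-06 g47 FILE D `ExitDefectContourSums.blk_contourPoint`
(the block label of a contour point) BY NAME; 0 `def`, 0 cited fact, 0 `def … : Prop`, 0 sorry).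
HONEST FRAMING (cell contract, verbatim): «discharging `BetaPertH` makes Bałaban's UV stability UNCONDITIONAL — a real constructive-QFT result; it is NOT the continuum limit and NOT
the Clay problem.»  HONEST DEPENDENCY (verbatim): «continuum YM on T⁴ ⇐ BetaPertH ∧ nine spine estimates (0/9 proved); BetaPertH ⇐ (D1) ∧ (D4) ∧ CAP+tail; G-an2-4 gates asym,
D1 and NE2/3/4.»

WHY.  The (γ) source pairing one level up (leaf-06 g48 B″ `GaugeReadSourcePairingSucc`, road-P2 g43 (5.2) `SlotMomentExitPairOfSourcePairing`) is `X_{j+1} = −𝒮_j(H_j h; H_j n, H_j dψ)`, and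
with FILE A's Wilson law, `DataColumnCombRows` (Euler–Lagrange at every bond) and adjointness its Wilson sector becomes `n^{−D}[½⟨𝒬_0(Ψ⁺⊙H_0 h), C_0 n⟩ − ¼⟨C_0 h, 𝒬_0(σ_Ψ⊙H_0 n)⟩]`
with the BLOCK-CONSTANT gauge function `Ψ = ψ ∘ blk` (`H_0 dψ = n^{−D} dΨ`).  This file is the lattice identity that moves the block-constant weight OUT of the contour sum: along the straight
contour of block `w` in direction `κ`, the `s`-th bond from `L•w + b` has its base point in block `w + [L ≤ b_κ + s]·e_κ` and its end point in block `w + [L ≤ b_κ + s + 1]·e_κ` (FILE D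
`blk_contourPoint`), so the weight is `ψ w` or `ψ(w + e_κ)` according to two explicit indicators, and the defects are the partial contour sums
`EI_L v κ w := Σ_{b∈box} Σ_{s<L} [b_κ + s + 1 < L]·v κ (L•w + b + s•e_κ)` (bonds whose END POINT is still inside `B(w)`; each in-block `κ`-bond at position `i ≤ L−2` counted `i + 1` times) and
`BO_L v κ w := Σ_{b∈box} Σ_{s<L} [L ≤ b_κ + s]·v κ (L•w + b + s•e_κ)` (bonds BASED in the next block `B(w + e_κ)`; position `i′` counted `L − 1 − i′` times) — written INLINE below (no `def`).
ENGINE E-leaf06-g49-1∕2 (E30∕E31, kit j178097 … j178383; D = 2, 3): the pairings `(C1′) = ⟨dψ⊙EI(H_0 h), C_0 n⟩`, `(C2′) = ⟨C_0 h, dψ⊙(BO − EI)(H_0 n)⟩` are the two defects of the closed form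
of `X_1`; at Bałaban's pins the `(C1′)` terms of the Wilson and border sectors cancel identically and the closed form rests on `(C2′) = 0` alone (true in D = 2 and 3 for two-level `h`,
block-periodic `n`, centred root).  This file asserts none of that: it is the bookkeeping identity both defects are MADE of.
* §1 `blk_contourPoint_succ` (the block of the END point of the `s`-th contour bond), `weight_end_eq`, `weight_base_eq` (the block-constant weight along the contour as indicators).
* §2 **`contourSum_endWeight_mul`** — `𝒬_L(Ψ⁺⊙v) κ w = ψ(w + e_κ)·𝒬_L v κ w − dz ψ κ w·EI_L v κ w`.
* §3 **`contourSum_baseWeight_mul`** — `𝒬_L(Ψ⊙v) κ w = ψ w·𝒬_L v κ w + dz ψ κ w·BO_L v κ w`.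
* §4 **`contourSum_bondSum_mul`** — `𝒬_L(σ_Ψ⊙v) κ w = (ψ w + ψ(w + e_κ))·𝒬_L v κ w + dz ψ κ w·(BO_L v κ w − EI_L v κ w)`; `contourSum_bondSum_blockInd_mul` (the label `ψ = 1_{y}`, i.e.
  `Ψ = 1_{B(y)}` of the (S) row: weight `[w = y] + [w + e_κ = y]`, defect sign `[w + e_κ = y] − [w = y]`).
Asserts nothing about any table, resolvent or response; NOTHING of (W-γ) ∕ (INV) ∕ (S) discharged; NEVER «G-an2-4 closed» as (CONV-C); NOT D1, NOT `BetaPertH`, NOT continuum, NOT Clay.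
2026-08-23; no existing file touched.
-/

noncomputable section

open Finset
open scoped BigOperators
open Literature.MathematicalPhysics.QuantumFieldTheory
open Literature.MathematicalPhysics.QuantumFieldTheory.Balaban1983to89
open Literature.MathematicalPhysics.QuantumFieldTheory.Balaban1983to89.Beta
open AffineAveraging (Form0 Form1 box toSite unitVec unitVec_apply dz contourSum)
open AveragingContours (blk blk_block)
open ExpKernelCalculus (Site)
open Summit.QuantumFields.BalabanUV.Beta.GAN24.ExitDefectContourSums (blk_contourPoint)

namespace Summit.QuantumFields.BalabanUV.Beta.GAN24.BlockWeightContourCommutation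

variable {d : ℕ}

/-! ## §1 The block of the end point of a contour bond; the weight along the contour -/

/-- [folklore] **THE BLOCK OF THE END POINT** of the `s`-th bond of the straight contour from `L•w + b` (`b ∈ box`, `s < L`): `blk L (L•w + b + s•e_κ + e_κ) = w + [L ≤ b_κ + s + 1]·e_κ`. -/
theorem blk_contourPoint_succ {L : ℕ} (hL : 1 ≤ L) (w : Site (d + 1)) {b : Fin (d + 1) → ℕ} (hb : b ∈ box (d + 1) L) (κ : Fin (d + 1)) {s : ℕ} (hs : s < L) :
    blk L ((L : ℤ) • w + toSite b + (s : ℤ) • unitVec κ + unitVec κ) = w + (if L ≤ b κ + (s + 1) then unitVec κ else 0) := by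
  have hbκ : b κ < L := Finset.mem_range.1 (Fintype.mem_piFinset.1 hb κ)
  have e : (L : ℤ) • w + toSite b + (s : ℤ) • unitVec κ + unitVec κ = (L : ℤ) • w + toSite b + ((s + 1 : ℕ) : ℤ) • unitVec κ := by
    push_cast; rw [add_smul, one_smul, add_assoc]
  rw [e]
  exact blk_contourPoint hL w hb κ (t := s + 1) (by omega)

/-- [folklore] **THE END-POINT WEIGHT ALONG THE CONTOUR**: for `Ψ = ψ ∘ blk L`, the value `Ψ(u + e_κ)` at the `s`-th contour bond `u = L•w + b + s•e_κ` is `ψ w` if `b_κ + s + 1 < L` and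
`ψ(w + e_κ)` otherwise. -/
theorem weight_end_eq {L : ℕ} (hL : 1 ≤ L) (ψ : Site (d + 1) → ℝ) (w : Site (d + 1)) {b : Fin (d + 1) → ℕ} (hb : b ∈ box (d + 1) L) (κ : Fin (d + 1)) {s : ℕ} (hs : s < L) :
    ψ (blk L ((L : ℤ) • w + toSite b + (s : ℤ) • unitVec κ + unitVec κ)) = if b κ + s + 1 < L then ψ w else ψ (w + unitVec κ) := by
  rw [blk_contourPoint_succ hL w hb κ hs]
  by_cases h : b κ + s + 1 < L
  · rw [if_neg (by omega), if_pos h, add_zero]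
  · rw [if_pos (by omega), if_neg h]

/-- [folklore] **THE BASE-POINT WEIGHT ALONG THE CONTOUR**: `Ψ(u)` at the `s`-th contour bond is `ψ(w + e_κ)` if `L ≤ b_κ + s` and `ψ w` otherwise. -/
theorem weight_base_eq {L : ℕ} (hL : 1 ≤ L) (ψ : Site (d + 1) → ℝ) (w : Site (d + 1)) {b : Fin (d + 1) → ℕ} (hb : b ∈ box (d + 1) L) (κ : Fin (d + 1)) {s : ℕ} (hs : s < L) :
    ψ (blk L ((L : ℤ) • w + toSite b + (s : ℤ) • unitVec κ)) = if L ≤ b κ + s then ψ (w + unitVec κ) else ψ w := by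
  have hbκ : b κ < L := Finset.mem_range.1 (Fintype.mem_piFinset.1 hb κ)
  rw [blk_contourPoint hL w hb κ (t := s) (by omega)]
  by_cases h : L ≤ b κ + s
  · rw [if_pos h, if_pos h]
  · rw [if_neg h, if_neg h, add_zero]

/-! ## §2 The end-point weight: `𝒬_L(Ψ⁺⊙v) = ψ⁺·𝒬_L v − dψ·EI_L v` -/

/-- NOT IN PRINT; OUR BOOKKEEPING.  **COMMUTING THE BLOCK-CONSTANT END-POINT WEIGHT THROUGH THE CONTOUR SUM** (`1 ≤ L`, `Ψ = ψ ∘ blk L`, any 1-form `v`, direction `κ`, block `w`):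
`𝒬_L(Ψ⁺⊙v) κ w = ψ(w + e_κ)·𝒬_L v κ w − (dz ψ) κ w·EI_L v κ w`, with the END-INSIDE partial contour sum `EI_L v κ w = Σ_{b∈box} Σ_{s<L} [b_κ + s + 1 < L]·v κ (L•w + b + s•e_κ)`. -/
theorem contourSum_endWeight_mul {L : ℕ} (hL : 1 ≤ L) (ψ : Site (d + 1) → ℝ) (v : Form1 (d + 1) ℝ) (κ : Fin (d + 1)) (w : Site (d + 1)) :
    contourSum L (fun κ' u => ψ (blk L (u + unitVec κ')) * v κ' u) κ w
      = ψ (w + unitVec κ) * contourSum L v κ w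
        - dz ψ κ w * ∑ b ∈ box (d + 1) L, ∑ s ∈ Finset.range L, (if b κ + s + 1 < L then v κ ((L : ℤ) • w + toSite b + (s : ℤ) • unitVec κ) else 0) := by
  classical
  simp only [AffineAveraging.contourSum, AffineAveraging.dz, Finset.mul_sum, ← Finset.sum_sub_distrib]
  refine Finset.sum_congr rfl fun b hb => Finset.sum_congr rfl fun s hs => ?_
  have hsL : s < L := Finset.mem_range.1 hs
  rw [weight_end_eq hL ψ w hb κ hsL]
  split_ifs with h
  · ring
  · ring

/-! ## §3 The base-point weight: `𝒬_L(Ψ⊙v) = ψ·𝒬_L v + dψ·BO_L v` -/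

/-- NOT IN PRINT; OUR BOOKKEEPING.  **COMMUTING THE BLOCK-CONSTANT BASE-POINT WEIGHT THROUGH THE CONTOUR SUM**:
`𝒬_L(Ψ⊙v) κ w = ψ w·𝒬_L v κ w + (dz ψ) κ w·BO_L v κ w`, with the BASE-OUTSIDE partial contour sum `BO_L v κ w = Σ_{b∈box} Σ_{s<L} [L ≤ b_κ + s]·v κ (L•w + b + s•e_κ)`. -/
theorem contourSum_baseWeight_mul {L : ℕ} (hL : 1 ≤ L) (ψ : Site (d + 1) → ℝ) (v : Form1 (d + 1) ℝ) (κ : Fin (d + 1)) (w : Site (d + 1)) :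
    contourSum L (fun κ' u => ψ (blk L u) * v κ' u) κ w
      = ψ w * contourSum L v κ w
        + dz ψ κ w * ∑ b ∈ box (d + 1) L, ∑ s ∈ Finset.range L, (if L ≤ b κ + s then v κ ((L : ℤ) • w + toSite b + (s : ℤ) • unitVec κ) else 0) := by
  classical
  simp only [AffineAveraging.contourSum, AffineAveraging.dz, Finset.mul_sum, ← Finset.sum_add_distrib]
  refine Finset.sum_congr rfl fun b hb => Finset.sum_congr rfl fun s hs => ?_
  have hsL : s < L := Finset.mem_range.1 hs
  rw [weight_base_eq hL ψ w hb κ hsL]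
  split_ifs with h
  · ring
  · ring

/-! ## §4 The bond sum `σ_Ψ = Ψ + Ψ⁺` and the block label of the (S) row -/

/-- NOT IN PRINT; OUR BOOKKEEPING.  **COMMUTING THE BLOCK-CONSTANT BOND SUM THROUGH THE CONTOUR SUM**:
`𝒬_L(σ_Ψ⊙v) κ w = (ψ w + ψ(w + e_κ))·𝒬_L v κ w + (dz ψ) κ w·(BO_L v κ w − EI_L v κ w)`, `σ_Ψ(κ,u) = Ψ u + Ψ(u + e_κ)`, `Ψ = ψ ∘ blk L`. -/
theorem contourSum_bondSum_mul {L : ℕ} (hL : 1 ≤ L) (ψ : Site (d + 1) → ℝ) (v : Form1 (d + 1) ℝ) (κ : Fin (d + 1)) (w : Site (d + 1)) :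
    contourSum L (fun κ' u => (ψ (blk L u) + ψ (blk L (u + unitVec κ'))) * v κ' u) κ w
      = (ψ w + ψ (w + unitVec κ)) * contourSum L v κ w
        + dz ψ κ w * ((∑ b ∈ box (d + 1) L, ∑ s ∈ Finset.range L, (if L ≤ b κ + s then v κ ((L : ℤ) • w + toSite b + (s : ℤ) • unitVec κ) else 0))
          - ∑ b ∈ box (d + 1) L, ∑ s ∈ Finset.range L, (if b κ + s + 1 < L then v κ ((L : ℤ) • w + toSite b + (s : ℤ) • unitVec κ) else 0)) := by
  have e : (fun κ' (u : Site (d + 1)) => (ψ (blk L u) + ψ (blk L (u + unitVec κ'))) * v κ' u)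
      = (fun κ' u => ψ (blk L u) * v κ' u) + (fun κ' u => ψ (blk L (u + unitVec κ')) * v κ' u) := by
    funext κ' u; simp only [Pi.add_apply]; ring
  have hadd : ∀ (A B : Form1 (d + 1) ℝ), contourSum L (A + B) κ w = contourSum L A κ w + contourSum L B κ w := fun A B => by
    simp only [AffineAveraging.contourSum, Pi.add_apply, Finset.sum_add_distrib]
  rw [e, hadd, contourSum_baseWeight_mul hL ψ v κ w, contourSum_endWeight_mul hL ψ v κ w]
  ring

/-- NOT IN PRINT; OUR BOOKKEEPING.  **THE BLOCK LABEL OF THE (S) ROW**: with `ψ = 1_{y}` on the coarse lattice (so `Ψ = 1_{B(y)}`),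
`𝒬_L(σ_{1_{B(y)}}⊙v) κ w = ([w = y] + [w + e_κ = y])·𝒬_L v κ w + ([w + e_κ = y] − [w = y])·(BO_L v κ w − EI_L v κ w)` — leaf-06 g47 FILE D's weights `1 ± τ` in closed form for EVERY `v`
(FILE D's `contourSum_bondSum_blockInd_eq_zero` is the special case `𝒬_L v κ w = 0` + transverse interior values). -/
theorem contourSum_bondSum_blockInd_mul {L : ℕ} (hL : 1 ≤ L) (y : Site (d + 1)) (v : Form1 (d + 1) ℝ) (κ : Fin (d + 1)) (w : Site (d + 1)) :
    contourSum L (fun κ' u => ((if blk L u = y then (1 : ℝ) else 0) + (if blk L (u + unitVec κ') = y then (1 : ℝ) else 0)) * v κ' u) κ w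
      = ((if w = y then (1 : ℝ) else 0) + (if w + unitVec κ = y then (1 : ℝ) else 0)) * contourSum L v κ w
        + ((if w + unitVec κ = y then (1 : ℝ) else 0) - (if w = y then (1 : ℝ) else 0))
          * ((∑ b ∈ box (d + 1) L, ∑ s ∈ Finset.range L, (if L ≤ b κ + s then v κ ((L : ℤ) • w + toSite b + (s : ℤ) • unitVec κ) else 0))
            - ∑ b ∈ box (d + 1) L, ∑ s ∈ Finset.range L, (if b κ + s + 1 < L then v κ ((L : ℤ) • w + toSite b + (s : ℤ) • unitVec κ) else 0)) := by
  classical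
  have h := contourSum_bondSum_mul hL (fun z : Site (d + 1) => if z = y then (1 : ℝ) else 0) v κ w
  simp only [AffineAveraging.dz] at h
  exact h

end Summit.QuantumFields.BalabanUV.Beta.GAN24.BlockWeightContourCommutation

end
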